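import Summits.QuantumFields.BalabanUV.T4Continuum.Support.NE3EnergyHessCont
import Summits.QuantumFields.BalabanUV.T4Continuum.Support.NE3EnergyAssembly

/-!
# T⁴ programme, node NE3, route P2 «ENERGY CONVEXITY» — sub-row S5-Y0-chart: THE CONVEXITY MECHANISM FROM THE CHART'S
# LEAVES, IN ANY NORM.  One hypothesis structure `ChartLeaves` (the 12 genuinely open chart ∕ representative ∕ coercivity
# clauses at one pair of minimisers, with the NORM A PARAMETER), the norm-generic END `norm_le_of_chartLeaves`
# (`NE3EnergyPath.energyResponse_of_pathData` BY NAME, the C²∕Hessian∕curvature fields discharged in the kernel), and the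
# unit-scale specialisation: `RouteLeaves` (node E9) and the ROOT T-E over `sfClass` from chart leaves alone

NE3 (node U1b) formalisation swarm `b2b-balaban-t4-ne3-formalise-*`, leaf seat `b2b-balaban-t4-ne3-formalise-leaf-03`
(gen 5), sub-row **S5-Y0-chart** of `HOME/t4/formal/NE3/LEAVES.md` (journal INTENT ∕ CLAIM l.12251; typer ρ92; the
successor item (ii) of the lineage's HANDOFF § leaf-03 gen 4), WRITTEN AFTER the row owner's located error
`HOME/t4/b2b-balaban-t4-ne3-p1/g19/F-ne3p1-g19-1.md` (2026-08-20T11:57Z): the energy-convexity road AS TYPED — tangent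
coercivity L5 with a k-free constant in the UNIT-SCALE norm `energyNorm² = curlSq + dirSq` — is refuted at the flat
background (k-fold tangent witness `cos(2πx₁/L^k)·E`, `hess/energyNorm² ≤ 4π²L^{−2k}`), and the surviving variant (R3) is
the SAME convexity mechanism in the η-WEIGHTED norm `N_w² = curlSq + L^{−2k}·dirSq` with a k-free weighted coercivity
(ML_w) and a curl-paired residual (RES♯).  The mechanism itself (`NE3EnergyPath.energyResponse_of_pathData`) is
norm-generic; what ties the tree's composition `NE3EnergyAssembly.RouteLeaves` to the dead currency is only its hard-wired
`energyNorm`.  THIS FILE therefore types the chart's leaves ONCE with the norm as a parameter and proves the END for every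
norm; the companion `Support/NE3EnergyChartLeavesWeighted` discharges the continuity constant in the weighted currency by
this lineage's two-term route (`NE3EnergyHessContTwoTerm.abs_hessSym_perWin_vary_le_weighted`).

* §1 `ChartLeaves 𝒞 L N k V U_A U_B u Γ Ψ Ψ′ T Nrm c θ κ θ₀ a : Prop` — at one pair, background `W := cavg L U_B`,
  period `P := N·L^k`: the representative's gauge `u` with `U_A^u = W·exp Γ(0)` (L1 REP); the path `Γ` with `Γ 1 = 0`, skew
  and `P`-periodic at all times, bondwise right-logarithmic velocity `Ψ t` and its derivative `Ψ′ t` on `[0,1]` (leaf L3's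
  `hE`∕`hΨ`; for B11's analytic chart segment: `NE3LinearisingPath` + `NE3EnergyPathC2Velocity` §7), admissibility of
  `W·exp Γ(t)` (L2 (a)), tangent datum `X := Ψ 1 ∈ T`, `T` periodic, the chart bounds `velocity`∕`close` IN THE NORM `Nrm`
  (L2 (b)), tangent coercivity of the Wilson Hessian on `T` along the path IN THE NORM `Nrm` (L5: `c·Nrm(Y)² ≤ hess W_t Y Y`),
  a plaquette radius `a` of `W_t` on the period window, the acceleration bound `a·Σ‖d_{W_t}Ψ′_t‖ ≤ κ·Nrm(X)²` (L7 × L2 (b)),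
  skewness of `Ψ 1` and `Ψ′ t`.  NOTHING about Hessian symmetry ∕ continuity, C²-regularity of the action, the dual residual.
* §2 `isPeriodicDir_vel` — the right-logarithmic velocity of a periodic path is periodic AT EACH TIME (pointwise twin of
  `NE3EnergyHessCont.isPeriodicDir_rvel`, by `NE3EnergyPathC2Velocity.rvel_unique`); `ChartLeaves.min_along` — minimality of
  `U_A` gives `A(W·exp Γ(0)) ≤ A(W·exp Γ(t))` (gauge invariance `NE3EnergyAssembly.fineAction_gaugeAct`).
* §3 **`norm_le_of_chartLeaves`** — THE END IN ANY NORM: for `Nrm ≥ 0`, chart leaves `h`, `U_A` a minimiser, `W` unitary,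
  a CONTINUITY clause `|HsPer W_t (perWin) P Y Z| ≤ Λ·Nrm Y·Nrm Z` (all `Y, Z`) and row Y9's residual SHAPE at `W` for the
  direction `Ψ 1` in the norm `Nrm` (`|d/ds A(W e^{sΨ₁})| ≤ r·Nrm(Ψ 1)`), under `0 < c` and the budget `2Λθ + Λθ² + κ ≤ c/2`:
  **`Nrm (Γ 0) ≤ (1 + θ₀)·(2r/c)`** — `act`∕`d1`∕`d2` by `NE3EnergyPathC2.hasDerivAt_fineAction_gpath`∕`hasDerivAt_dAction_gpath`,
  `symm`∕`split` by `NE3EnergyHessCont.HsPer_symm`∕`HsPer_self_of_periodic` + §2, `curv` by `NE3EnergyHessCont.abs_e_le`, `res`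
  by `NE3EnergyHessBilin.res_field_of_endW`, the response by `NE3EnergyPath.energyResponse_of_pathData` ∕ `energyResponse_half`.
  The weighted road (R3) instantiates `Nrm := N_w`, `c := c_w` (ML_w), `r := r♯` (RES♯), `Λ := Λ_w` (companion file).
* §4 THE UNIT-SCALE SPECIALISATION `Nrm := energyNorm W · (periodBox P)` (road P2 AS TYPED — every statement a VALID kernel
  implication; the road is DEAD AS TYPED per F-ne3p1-g19-1 (R1): no k-free `c` exists in this currency — said here, not
  hidden): **`routeLeaves_of_chartLeaves`** (`RouteLeaves … (Ψ 1) … (48·d) … r` with the dictionary `φ t := A(W·exp Γ(t))`,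
  `φ′ t := dAction W_t (Ψ t)`, `φ″ t := hess W_t (Ψ t)(Ψ t) + dAction W_t (Ψ′ t)`, `Hs t := HsPer W_t (perWin) P`, `uu t := Ψ t − Ψ 1`,
  `e t := dAction W_t (Ψ′ t)`; `cont` with `Λ = 48·d` by `NE3EnergyHessCont.abs_HsPer_le_energyNorm`), `isUnitaryCfg_cavg_of_regular`,
  **`routeLeaves_sfClass_of_chartLeaves`** (over `sfClass`, `k = j+1`: `res` is row Y9's THEOREM
  `NE3EnergyResidual.abs_deriv_action_le_residualScale`, so `RouteLeaves … (residualScale d L N b g (j+1))` follows from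
  `ChartLeaves` + `TangentIter L j W (Ψ 1)` ALONE) and **`ne3EnergyRate_sfClass_of_chartLeaves`** (the typed ROOT
  `NE3EnergyRate d (sfClass d L N ε) L N b g ((1+θ₀)·(2/c)) dom` from chart leaves at every pair, via
  `NE3EnergyAssembly.ne3EnergyRate_of_routeLeaves`).

WHAT REMAINS of T-E, AS LEAN HYPOTHESES, after this file: `ChartLeaves.rep` (L1 REP, B11 Prop. 2 TYPE), `.adm ∕ vel ∕ acc ∕
velocity ∕ close ∕ small ∕ accel` + `TangentIter` (L2 — the torus instantiation of `NE3Linearising.exists_linearising_path` ∕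
`NE3LinearisingPath.exists_chartPath_kinematics`; L2-i `ReplicationRightInverse` landed, L2-ii k-uniform quadratic constant
OPEN), `.coer` (L5: DEAD k-uniformly for `Nrm = energyNorm`; = ML_w for `Nrm = N_w`, not in the tree), the continuity
clause (discharged: `Λ = 48d` unit-scale here; `Λ_w` weighted in the companion), the residual shape (unit-scale: row Y9's
theorem; weighted with decay: RES♯, not in the tree), row Y9's multi-level smallness.

HONEST FRAMING.  Finite-T⁴ bookkeeping (rung (B)+1); kernel composition of landed lemmas; `ChartLeaves` is a HYPOTHESIS
SHAPE asserted for no configuration of Bałaban's (non-vacuity in the companion file: flat data); T-E NOT proved and, per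
the row owner, WITHOUT a surviving road in the unit-scale currency; NE3 NOT proved; spine PROVED 0∕9; no conditional of the
cell (`BetaPertH`, (B), (B^μ)) used or hidden; NOT infinite volume, NOT a mass gap, NOT Clay, NOT summit progress.  ABSOLUTE
RULE kept: no printed sentence is a hypothesis of a theorem (context only: [Balaban1985Variational] (19)–(21) p. 281,
(47)–(58) pp. 285–287, Prop. 3 p. 289, (81)–(84) p. 290).  PLACEMENT: `Summits/QuantumFields/BalabanUV/`; imports this
lineage's `Support.NE3EnergyHessCont` (gen 3) and road P2's `Support.NE3EnergyAssembly` BY NAME; ONE hypothesis structure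
(`ChartLeaves`, a `Prop`), no other `def`, no `sorry`.  HONEST DEPENDENCY: continuum YM on T⁴ ⇐ BetaPertH ∧ nine spine
estimates (0/9 proved); BetaPertH ⇐ (D1) ∧ (D4) ∧ CAP+tail; G-an2-4 gates asym, D1 and NE2/3/4.
-/

set_option autoImplicit false

open scoped BigOperators Matrix.Norms.L2Operator
open NormedSpace Finset

namespace Summit.QuantumFields.BalabanUV.T4Continuum.NE3EnergyChartLeaves

open Set
open Literature.MathematicalPhysics.QuantumFieldTheory.Balaban1983to89
open B7Prop1Explicit B7Prop2Explicit MatrixLog UnitaryModel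
open T4AveragingDeficitWall hiding Site Plane Plaq Bond
open T4AveragingDeficitWallBoundary (IsPeriodicCfg periodBox)
open AveragingDeficitPeriodicCounting (IsPeriodicDir)
open AveragingDeficitChartCalculus (cavg)
open AveragingDeficitTwoLevelPrep (twoLevelSmall cavg_isUnitaryCfg smallness_of_twoLevelSmall)
open AveragingDeficitFermat (small512_of_liftSmall)
open AveragingDeficitMultiLevelPrep (LevelSmall TangentIter)
open AveragingDeficitPlaqDeriv (vary_isUnitaryCfg)
open MinimalActionLevels (perWin levelAction stepWt stepWt_pos)
open MinimalActionSandwich (IsMinimiser admissible)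
open MinimalActionRate (Regular sfClass)
open NE3EnergyShapes (energyNorm energyNorm_nonneg residualScale residualScale_nonneg IsUnitarySite IsPeriodicSite
  NE3EnergyRate)
open NE3HessForm (dAction hess)
open NE3EnergyHessBilin (hessSym res_field_of_endW)
open NE3EnergyHessCont (HsPer HsPer_symm HsPer_self_of_periodic abs_HsPer_le_energyNorm abs_e_le)
open NE3EnergyPathC2 (hasDerivAt_fineAction_gpath hasDerivAt_dAction_gpath)
open NE3EnergyPathC2Velocity (rvel_unique)
open NE3EnergyResidual (abs_deriv_action_le_residualScale)
open NE3EnergyAssembly (RouteLeaves ne3EnergyRate_of_routeLeaves fineAction_gaugeAct)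
open NE3EnergyPath (energyResponse_of_pathData energyResponse_half modulus_ge_half)

noncomputable section

variable {d : ℕ} {n : Type*} [Fintype n] [DecidableEq n]

/-! ## §1 The chart's leaves at one pair of minimisers, as one hypothesis structure -/

/-- **THE CHART'S LEAVES AT ONE PAIR** `(U_A, U_B)` of run-A ∕ run-B configurations of the datum `V` (level `k`, class
family `𝒞`, torus side `N`), background `W := cavg L U_B`, period `P := N·L^k`, window `perWin d P`, tangent datum `X := Ψ 1`.  DATA: the representative's gauge `u`, the path of
directions `Γ` with its bondwise right-logarithmic velocity `Ψ` and acceleration `Ψ′`, the tangent space `T`, constants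
`(c, θ, κ, θ₀)`, the plaquette radius `a` along the path, and THE NORM `Nrm` on direction fields in which the chart bounds and
the coercivity are measured (unit-scale `energyNorm W · (periodBox P)` for road P2 as typed, §4; the η-weighted `N_w` for the
surviving variant (R3), companion file).  FIELDS: L1 REP (`gauge`, `rep`); the chart path L2 (`endW`, `skew`, `per`, `vel`,
`acc`, `skewEnd`, `skewAcc`, `adm`, `tangent`, `perT`, `velocity`, `close`, `small`, `accel`); L5 (`coer`, the Wilson Hessian
itself on `T` along the path).  A SHAPE: asserted for no configuration of Bałaban's. [folklore] -/
@[folklore]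
structure ChartLeaves (𝒞 : ℕ → Set (Site d → Fin d → (Matrix n n ℂ)ˣ)) (L N k : ℕ)
    (V UA UB : Site d → Fin d → (Matrix n n ℂ)ˣ) (u : Site d → (Matrix n n ℂ)ˣ)
    (Γ Ψ Ψ' : ℝ → Site d → Fin d → Matrix n n ℂ) (T : Set (Site d → Fin d → Matrix n n ℂ))
    (Nrm : (Site d → Fin d → Matrix n n ℂ) → ℝ) (c θ κ θ₀ a : ℝ) : Prop where
  /-- L1 REP: the gauge transformation is `U(N)`-valued and periodic -/
  gauge : IsUnitarySite u ∧ IsPeriodicSite u ((N * L ^ k : ℕ) : ℤ)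
  /-- L1 REP: `U_A^u = W·exp Γ(0)` -/
  rep : gaugeAct u UA = vary (cavg L UB) (Γ 0) 1
  /-- L2: the path ends at the background: `Γ 1 = 0` -/
  endW : Γ 1 = 0
  /-- L2: the path fields are `𝔲(N)`-valued at all times -/
  skew : ∀ t, IsSkewDir (Γ t)
  /-- L2: the path fields are periodic at all times -/
  per : ∀ t, IsPeriodicDir (Γ t) ((N * L ^ k : ℕ) : ℤ)
  /-- L2∕L3: `Ψ t` is the bondwise right-logarithmic velocity of the path on `[0,1]` -/
  vel : ∀ t ∈ Icc (0:ℝ) 1, ∀ (y : Site d) (μ : Fin d),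
    HasDerivAt (fun s => exp (Γ s y μ)) (exp (Γ t y μ) * Ψ t y μ) t
  /-- L2∕L3: `Ψ′ t` is the bondwise derivative of the velocity on `[0,1]` -/
  acc : ∀ t ∈ Icc (0:ℝ) 1, ∀ (y : Site d) (μ : Fin d), HasDerivAt (fun s => Ψ s y μ) (Ψ' t y μ) t
  /-- L2: the tangent datum `X := Ψ 1` is `𝔲(N)`-valued -/
  skewEnd : IsSkewDir (Ψ 1)
  /-- L2: the accelerations are `𝔲(N)`-valued on `[0,1]` -/
  skewAcc : ∀ t ∈ Icc (0:ℝ) 1, IsSkewDir (Ψ' t)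
  /-- L2 (a): the path stays in run A's fibre and class -/
  adm : ∀ t ∈ Icc (0:ℝ) 1, vary (cavg L UB) (Γ t) 1 ∈ admissible 𝒞 L k V
  /-- L2: the tangent datum lies in the tangent space -/
  tangent : Ψ 1 ∈ T
  /-- the tangent space consists of periodic directions -/
  perT : ∀ Y ∈ T, IsPeriodicDir Y ((N * L ^ k : ℕ) : ℤ)
  /-- L2 (b): the non-tangent part of the velocity is `θ`-small in the norm `Nrm` -/
  velocity : ∀ t ∈ Icc (0:ℝ) 1, Nrm (Ψ t - Ψ 1) ≤ θ * Nrm (Ψ 1)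
  /-- L2 (b): the start of the path is `(1+θ₀)`-close to the tangent datum in the norm `Nrm` -/
  close : Nrm (Γ 0) ≤ (1 + θ₀) * Nrm (Ψ 1)
  /-- L5: tangent coercivity of the Wilson Hessian on `T` along the path, in the norm `Nrm` -/
  coer : ∀ t ∈ Icc (0:ℝ) 1, ∀ Y ∈ T, c * Nrm Y ^ 2 ≤ hess (vary (cavg L UB) (Γ t) 1) Y Y (perWin d (N * L ^ k))
  /-- L2∕L7: a plaquette radius of the moving configuration on the period window -/
  small : ∀ t ∈ Icc (0:ℝ) 1, ∀ p ∈ perWin d (N * L ^ k),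
    ‖((fhol (vary (cavg L UB) (Γ t) 1) p : (Matrix n n ℂ)ˣ) : Matrix n n ℂ) - 1‖ ≤ a
  /-- L7 × L2 (b): the acceleration bound of the chart, in the norm `Nrm` -/
  accel : ∀ t ∈ Icc (0:ℝ) 1, a * ∑ p ∈ perWin d (N * L ^ k), ‖curl (vary (cavg L UB) (Γ t) 1) (Ψ' t) p‖
    ≤ κ * Nrm (Ψ 1) ^ 2

/-! ## §2 The velocity of a periodic path is periodic at each time; minimality along the path -/

/-- THE RIGHT-LOGARITHMIC VELOCITY OF A PERIODIC PATH IS PERIODIC, AT EACH TIME: if every `Γ s` is `P`-periodic and `Ψ t`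
is a bondwise right-logarithmic velocity of `Γ` at the time `t`, then `Ψ t` is `P`-periodic (uniqueness of the velocity,
`NE3EnergyPathC2Velocity.rvel_unique`; pointwise-in-time twin of `NE3EnergyHessCont.isPeriodicDir_rvel`). [folklore] -/
theorem isPeriodicDir_vel {Γ Ψ : ℝ → Site d → Fin d → Matrix n n ℂ} {P : ℤ} (hΓ : ∀ s, IsPeriodicDir (Γ s) P)
    {t : ℝ} (hE : ∀ (y : Site d) (μ : Fin d), HasDerivAt (fun s => exp (Γ s y μ)) (exp (Γ t y μ) * Ψ t y μ) t) :
    IsPeriodicDir (Ψ t) P := by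
  intro x i μ
  have h1 := hE (x + P • e i) μ
  have hfun : (fun s => exp (Γ s (x + P • e i) μ)) = fun s => exp (Γ s x μ) :=
    funext fun s => by rw [hΓ s x i μ]
  rw [hfun, hΓ t x i μ] at h1
  exact rvel_unique h1 (hE x μ)

/-- MINIMALITY ALONG THE PATH: under `ChartLeaves`, if `U_A` minimises run `k` (`IsMinimiser`, p204506) then
`A(W·exp Γ(0)) ≤ A(W·exp Γ(t))` on the period window for `t ∈ (0,1)` — `A(W·exp Γ(0)) = A(U_A^u) = A(U_A)` (field `rep` and
the gauge invariance `NE3EnergyAssembly.fineAction_gaugeAct`) and `A(U_A) ≤ A(W·exp Γ(t))` because the path is admissible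
(`levelAction = (stepWt⁻¹)^k · fineAction`, positive weight).  Twin of `NE3EnergyAssembly.RouteLeaves.min_along`. [folklore] -/
theorem ChartLeaves.min_along {𝒞 : ℕ → Set (Site d → Fin d → (Matrix n n ℂ)ˣ)} {L N k : ℕ} (hL : 1 ≤ L)
    {V UA UB : Site d → Fin d → (Matrix n n ℂ)ˣ} {u : Site d → (Matrix n n ℂ)ˣ}
    {Γ Ψ Ψ' : ℝ → Site d → Fin d → Matrix n n ℂ} {T : Set (Site d → Fin d → Matrix n n ℂ)}
    {Nrm : (Site d → Fin d → Matrix n n ℂ) → ℝ} {c θ κ θ₀ a : ℝ}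
    (h : ChartLeaves 𝒞 L N k V UA UB u Γ Ψ Ψ' T Nrm c θ κ θ₀ a) (hA : IsMinimiser d 𝒞 L N k V UA) :
    ∀ t ∈ Ioo (0:ℝ) 1, (fun s => fineAction (vary (cavg L UB) (Γ s) 1) (perWin d (N * L ^ k))) 0
      ≤ (fun s => fineAction (vary (cavg L UB) (Γ s) 1) (perWin d (N * L ^ k))) t := by
  intro t ht
  have hc : 0 < ((stepWt d L)⁻¹) ^ k := pow_pos (inv_pos.mpr (stepWt_pos (d := d) L hL)) k
  have hle := hA.le _ (h.adm t (Ioo_subset_Icc_self ht))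
  unfold MinimalActionLevels.levelAction at hle
  have hle' := le_of_mul_le_mul_left hle hc
  show fineAction (vary (cavg L UB) (Γ 0) 1) (perWin d (N * L ^ k))
    ≤ fineAction (vary (cavg L UB) (Γ t) 1) (perWin d (N * L ^ k))
  rw [← h.rep, fineAction_gaugeAct]
  exact hle'

/-! ## §3 The END in any norm: the convexity mechanism from the chart's leaves -/

/-- **THE END IN ANY NORM.**  For any class family `𝒞`, level `k`, a unitary background `W = cavg L U_B` (`hW`), a
non-negative functional `Nrm` on direction fields, chart leaves `h : ChartLeaves 𝒞 L N k V U_A U_B u Γ Ψ Ψ′ T Nrm c θ κ θ₀ a`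
at a pair whose run-A member `U_A` is a minimiser, a CONTINUITY clause for the periodised symmetrised Hessian
`Hs t := HsPer W_t (perWin d P) P` in the norm `Nrm` with constant `Λ ≥ 0` (all directions), and row Y9's residual SHAPE
at `W` for the direction `Ψ 1` in the norm `Nrm` with constant `r ≥ 0`, under `0 < c`, `0 ≤ θ₀` and the modulus budget
`2Λθ + Λθ² + κ ≤ c/2`:  **`Nrm (Γ 0) ≤ (1 + θ₀)·(2r/c)`**.  The C² fields (`NE3EnergyPathC2.hasDerivAt_fineAction_gpath`,
`hasDerivAt_dAction_gpath`), the Hessian splitting (`HsPer_symm`, `HsPer_self_of_periodic`, §2), the curvature term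
(`NE3EnergyHessCont.abs_e_le` + `accel`), the end-point residual (`NE3EnergyHessBilin.res_field_of_endW`) and minimality
(`ChartLeaves.min_along`) are discharged inside; the response is `NE3EnergyPath.energyResponse_of_pathData` ∕
`energyResponse_half` BY NAME.  Norm-generic: the unit-scale road takes `Nrm := energyNorm W · (periodBox P)` (§4, DEAD
k-uniformly per F-ne3p1-g19-1), the surviving variant (R3) takes the η-weighted norm (companion file). [folklore] -/
theorem norm_le_of_chartLeaves [Nonempty n] {𝒞 : ℕ → Set (Site d → Fin d → (Matrix n n ℂ)ˣ)} {L N k : ℕ}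
    (hL : 1 ≤ L) {V UA UB : Site d → Fin d → (Matrix n n ℂ)ˣ} (hW : IsUnitaryCfg (cavg L UB))
    {u : Site d → (Matrix n n ℂ)ˣ} {Γ Ψ Ψ' : ℝ → Site d → Fin d → Matrix n n ℂ}
    {T : Set (Site d → Fin d → Matrix n n ℂ)} {Nrm : (Site d → Fin d → Matrix n n ℂ) → ℝ}
    (hNrm : ∀ Y, 0 ≤ Nrm Y) {c Λ θ κ θ₀ a r : ℝ}
    (h : ChartLeaves 𝒞 L N k V UA UB u Γ Ψ Ψ' T Nrm c θ κ θ₀ a) (hA : IsMinimiser d 𝒞 L N k V UA)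
    (hΛ : 0 ≤ Λ) (hθ₀ : 0 ≤ θ₀) (hr : 0 ≤ r) (hc : 0 < c) (hbudget : 2 * Λ * θ + Λ * θ ^ 2 + κ ≤ c / 2)
    (hcont : ∀ t ∈ Icc (0:ℝ) 1, ∀ Y Z : Site d → Fin d → Matrix n n ℂ,
      |HsPer (vary (cavg L UB) (Γ t) 1) (perWin d (N * L ^ k)) (N * L ^ k) Y Z| ≤ Λ * Nrm Y * Nrm Z)
    (hres : ∀ D : ℝ, HasDerivAt (fun s : ℝ => fineAction (vary (cavg L UB) (Ψ 1) s) (perWin d (N * L ^ k))) D 0 →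
      |D| ≤ r * Nrm (Ψ 1)) :
    Nrm (Γ 0) ≤ (1 + θ₀) * (2 * r / c) := by
  -- periodicity of the velocities on `[0,1]` (§2) and unitarity of the moving configuration
  have hΨP : ∀ t ∈ Icc (0:ℝ) 1, IsPeriodicDir (Ψ t) ((N * L ^ k : ℕ) : ℤ) :=
    fun t ht => isPeriodicDir_vel h.per (h.vel t ht)
  have hWt : ∀ t, IsUnitaryCfg (vary (cavg L UB) (Γ t) 1) := fun t => vary_isUnitaryCfg hW (h.skew t) 1
  have hm : 0 < c - 2 * Λ * θ - Λ * θ ^ 2 - κ := by linarith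
  have hX : Nrm (Ψ 1) ≤ r / (c - 2 * Λ * θ - Λ * θ ^ 2 - κ) :=
    energyResponse_of_pathData
      (φ := fun s => fineAction (vary (cavg L UB) (Γ s) 1) (perWin d (N * L ^ k)))
      (φ' := fun s => dAction (vary (cavg L UB) (Γ s) 1) (Ψ s) (perWin d (N * L ^ k)))
      (φ'' := fun s => hess (vary (cavg L UB) (Γ s) 1) (Ψ s) (Ψ s) (perWin d (N * L ^ k))
        + dAction (vary (cavg L UB) (Γ s) 1) (Ψ' s) (perWin d (N * L ^ k)))
      (fun s => HsPer (vary (cavg L UB) (Γ s) 1) (perWin d (N * L ^ k)) (N * L ^ k))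
      (fun t _ x y => HsPer_symm _ _ _ x y) Nrm hNrm T hΛ hr
      (fun t ht Y hY => by
        simp only [HsPer_self_of_periodic _ _ _ (h.perT Y hY)]
        exact h.coer t ht Y hY)
      hcont h.tangent (fun s => Ψ s - Ψ 1) h.velocity
      (fun s => dAction (vary (cavg L UB) (Γ s) 1) (Ψ' s) (perWin d (N * L ^ k)))
      (fun t ht => (abs_e_le (hWt t) (h.skewAcc t ht) _ (h.small t ht)).trans (h.accel t ht))
      (fun t ht => hasDerivAt_fineAction_gpath (cavg L UB) (h.vel t ht) (perWin d (N * L ^ k)))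
      (fun t ht => hasDerivAt_dAction_gpath (cavg L UB) (h.vel t ht) (h.acc t ht) (perWin d (N * L ^ k)))
      (fun t ht => by simp only [add_sub_cancel, HsPer_self_of_periodic _ _ _ (hΨP t ht)])
      (h.min_along hL hA)
      (res_field_of_endW (cavg L UB) Γ Ψ h.endW (perWin d (N * L ^ k)) hres) hm
  have hX' : Nrm (Ψ 1) ≤ 2 * r / c := energyResponse_half hc hr (modulus_ge_half hbudget) hX
  calc Nrm (Γ 0) ≤ (1 + θ₀) * Nrm (Ψ 1) := h.close
    _ ≤ (1 + θ₀) * (2 * r / c) := mul_le_mul_of_nonneg_left hX' (by linarith)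

/-! ## §4 The unit-scale specialisation `Nrm := energyNorm W · (periodBox P)`: `RouteLeaves` (node E9) and the ROOT T-E
over `sfClass` — road P2 AS TYPED (valid implications; DEAD k-uniformly per F-ne3p1-g19-1 (R1)) -/

/-- **THE ROUTE'S LEAVES FROM THE CHART'S LEAVES (unit-scale currency, class-agnostic).**  For any class family `𝒞`,
level `k`, a unitary background `W = cavg L U_B` (`hW`), `1 ≤ N·L^k`, chart leaves in the unit-scale norm
`Nrm := energyNorm W · (periodBox (N·L^k))` and row Y9's residual SHAPE at `W` for the direction `Ψ 1` (`hres`), the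
route's leaves `RouteLeaves 𝒞 L N k V U_A U_B u (Ψ 1) Γ φ φ′ φ″ Hs uu e T c (48·d) θ κ θ₀ r` hold with the dictionary of the
module docstring.  Discharged inside: `act` (rfl), `d1`∕`d2` (`NE3EnergyPathC2.hasDerivAt_fineAction_gpath`∕`hasDerivAt_dAction_gpath`),
`symm` (`HsPer_symm`), `split` (`HsPer_self_of_periodic` + §2), `cont` with `Λ = 48·d` (`abs_HsPer_le_energyNorm`), `coer`
(read through `HsPer_self_of_periodic`), `curv` (`abs_e_le` + `accel`), `res` (`res_field_of_endW` + `hres`), `dirZ`.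
[folklore] -/
theorem routeLeaves_of_chartLeaves [Nonempty n] {𝒞 : ℕ → Set (Site d → Fin d → (Matrix n n ℂ)ˣ)} {L N k : ℕ}
    (hP : 1 ≤ N * L ^ k) {V UA UB : Site d → Fin d → (Matrix n n ℂ)ˣ} (hW : IsUnitaryCfg (cavg L UB))
    {u : Site d → (Matrix n n ℂ)ˣ} {Γ Ψ Ψ' : ℝ → Site d → Fin d → Matrix n n ℂ}
    {T : Set (Site d → Fin d → Matrix n n ℂ)} {c θ κ θ₀ a r : ℝ}
    (h : ChartLeaves 𝒞 L N k V UA UB u Γ Ψ Ψ' T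
      (fun Y => energyNorm (cavg L UB) Y (periodBox (N * L ^ k))) c θ κ θ₀ a)
    (hres : ∀ D : ℝ, HasDerivAt (fun s : ℝ => fineAction (vary (cavg L UB) (Ψ 1) s) (perWin d (N * L ^ k))) D 0 →
      |D| ≤ r * energyNorm (cavg L UB) (Ψ 1) (periodBox (N * L ^ k))) :
    RouteLeaves 𝒞 L N k V UA UB u (Ψ 1) Γ
      (fun t => fineAction (vary (cavg L UB) (Γ t) 1) (perWin d (N * L ^ k)))
      (fun t => dAction (vary (cavg L UB) (Γ t) 1) (Ψ t) (perWin d (N * L ^ k)))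
      (fun t => hess (vary (cavg L UB) (Γ t) 1) (Ψ t) (Ψ t) (perWin d (N * L ^ k))
        + dAction (vary (cavg L UB) (Γ t) 1) (Ψ' t) (perWin d (N * L ^ k)))
      (fun t => HsPer (vary (cavg L UB) (Γ t) 1) (perWin d (N * L ^ k)) (N * L ^ k))
      (fun t => Ψ t - Ψ 1) (fun t => dAction (vary (cavg L UB) (Γ t) 1) (Ψ' t) (perWin d (N * L ^ k)))
      T c (48 * d) θ κ θ₀ r := by
  -- periodicity of the velocities on `[0,1]` (§2) and unitarity of the moving configuration
  have hΨP : ∀ t ∈ Icc (0:ℝ) 1, IsPeriodicDir (Ψ t) ((N * L ^ k : ℕ) : ℤ) :=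
    fun t ht => isPeriodicDir_vel h.per (h.vel t ht)
  have hWt : ∀ t, IsUnitaryCfg (vary (cavg L UB) (Γ t) 1) := fun t => vary_isUnitaryCfg hW (h.skew t) 1
  refine
    { gauge := h.gauge
      rep := h.rep
      endW := h.endW
      dirZ := ⟨h.skew 0, h.per 0⟩
      adm := h.adm
      tangent := h.tangent
      velocity := h.velocity
      close := h.close
      act := fun _ => rfl
      d1 := fun t ht => hasDerivAt_fineAction_gpath (cavg L UB) (h.vel t ht) (perWin d (N * L ^ k))
      d2 := fun t ht => hasDerivAt_dAction_gpath (cavg L UB) (h.vel t ht) (h.acc t ht) (perWin d (N * L ^ k))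
      symm := fun t _ x y => HsPer_symm _ _ _ x y
      split := fun t ht => ?_
      coer := fun t ht Y hY => ?_
      cont := fun t _ Y Z => abs_HsPer_le_energyNorm (hWt t) (cavg L UB) hP Y Z
      curv := fun t ht => ?_
      res := ?_ }
  · -- `split`: `X + (Ψ t − X) = Ψ t` and `HsPer` IS `hess` on the periodic direction `Ψ t`
    simp only [add_sub_cancel, HsPer_self_of_periodic _ _ _ (hΨP t ht)]
  · -- `coer`: read through `HsPer_self_of_periodic` on the periodic tangent direction `Y`
    simp only [HsPer_self_of_periodic _ _ _ (h.perT Y hY)]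
    exact h.coer t ht Y hY
  · -- `curv`: the curvature term is a first variation (`abs_e_le`) and the chart's acceleration bound
    exact (abs_e_le (hWt t) (h.skewAcc t ht) _ (h.small t ht)).trans (h.accel t ht)
  · -- `res`: row Y9's shape at the background, for the direction `Ψ 1`
    exact res_field_of_endW (cavg L UB) Γ Ψ h.endW (perWin d (N * L ^ k)) hres

/-- B7 Prop. 1's unitarity of the background `cavg L U_B` for a `Regular d L N b g (j+2)` configuration under row Y9's
multi-level smallness with `0 ≤ b < ε` (`cavg_isUnitaryCfg` BY NAME; the `512(d+1)(d+4)L²`-smallness from `LevelSmall`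
through `smallness_of_twoLevelSmall` and `small512_of_liftSmall`). [folklore] -/
theorem isUnitaryCfg_cavg_of_regular [Nonempty n] {L N : ℕ} (hL : 1 ≤ L) (j : ℕ) {ε b g : ℝ} (hb : 0 ≤ b)
    (hbε : b < ε) (hsmall : LevelSmall d L (j + 1) (ε / ((L : ℝ) ^ (j + 2)) ^ 2))
    {UB : Site d → Fin d → (Matrix n n ℂ)ˣ} (hreg : Regular d L N b g (j + 2) UB) :
    IsUnitaryCfg (cavg L UB) := by
  have hL0 : (0 : ℝ) < L := by exact_mod_cast hL
  have hLpos : (0 : ℝ) < ((L : ℝ) ^ (j + 2)) ^ 2 := by positivity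
  have ha : 0 ≤ b / ((L : ℝ) ^ (j + 2)) ^ 2 := div_nonneg hb hLpos.le
  have hab : b / ((L : ℝ) ^ (j + 2)) ^ 2 ≤ ε / ((L : ℝ) ^ (j + 2)) ^ 2 :=
    div_le_div_of_nonneg_right hbε.le hLpos.le
  have htwo : twoLevelSmall d L * (b / ((L : ℝ) ^ (j + 2)) ^ 2) ≤ 1 := by
    have h2 := hsmall.two
    have hts : 0 ≤ twoLevelSmall d L := by unfold AveragingDeficitTwoLevelPrep.twoLevelSmall; positivity
    exact (mul_le_mul_of_nonneg_left hab hts).trans h2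
  obtain ⟨hlift, -, -, -⟩ := smallness_of_twoLevelSmall (d := d) hL ha htwo
  have h512 := small512_of_liftSmall hL ha hlift
  exact cavg_isUnitaryCfg hL hreg.unitary ha h512 hreg.small

/-- **THE ROUTE'S LEAVES FROM THE CHART'S LEAVES OVER `sfClass`.**  Levels written `j+1` (run A) and `j+2` (run B).
For a run-B minimiser `U_B` of `sfClass d L N ε` with datum `V` that is `Regular d L N b g (j+2)`, `0 ≤ b < ε`, under the
multi-level smallness `LevelSmall d L (j+1) (ε∕(L^{j+2})²)`, chart leaves in the unit-scale norm at the pair `(U_A, U_B)` and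
tangency of the tangent datum to run A's fibre (`TangentIter L j (cavg L U_B) (Ψ 1)`): the route's leaves hold with the
residual constant `r = residualScale d L N b g (j+1)` of row Y9 and `Λ = 48·d` — `res` is
`NE3EnergyResidual.abs_deriv_action_le_residualScale` BY NAME, the background's unitarity is `isUnitaryCfg_cavg_of_regular`.
[folklore] -/
theorem routeLeaves_sfClass_of_chartLeaves [Nonempty n] {L N : ℕ} [NeZero L] [NeZero N] (hL : 1 ≤ L) (hN : 1 ≤ N)
    (j : ℕ) {ε b g : ℝ} (hb : 0 ≤ b) (hbε : b < ε)
    (hsmall : LevelSmall d L (j + 1) (ε / ((L : ℝ) ^ (j + 2)) ^ 2))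
    {V UA UB : Site d → Fin d → (Matrix n n ℂ)ˣ}
    (hB : IsMinimiser d (sfClass d L N ε) L N (j + 2) V UB) (hreg : Regular d L N b g (j + 2) UB)
    {u : Site d → (Matrix n n ℂ)ˣ} {Γ Ψ Ψ' : ℝ → Site d → Fin d → Matrix n n ℂ}
    {T : Set (Site d → Fin d → Matrix n n ℂ)} {c θ κ θ₀ a : ℝ}
    (h : ChartLeaves (sfClass d L N ε) L N (j + 1) V UA UB u Γ Ψ Ψ' T
      (fun Y => energyNorm (cavg L UB) Y (periodBox (N * L ^ (j + 1)))) c θ κ θ₀ a)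
    (hXT : TangentIter L j (cavg L UB) (Ψ 1)) :
    RouteLeaves (sfClass d L N ε) L N (j + 1) V UA UB u (Ψ 1) Γ
      (fun t => fineAction (vary (cavg L UB) (Γ t) 1) (perWin d (N * L ^ (j + 1))))
      (fun t => dAction (vary (cavg L UB) (Γ t) 1) (Ψ t) (perWin d (N * L ^ (j + 1))))
      (fun t => hess (vary (cavg L UB) (Γ t) 1) (Ψ t) (Ψ t) (perWin d (N * L ^ (j + 1)))
        + dAction (vary (cavg L UB) (Γ t) 1) (Ψ' t) (perWin d (N * L ^ (j + 1))))
      (fun t => HsPer (vary (cavg L UB) (Γ t) 1) (perWin d (N * L ^ (j + 1))) (N * L ^ (j + 1)))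
      (fun t => Ψ t - Ψ 1) (fun t => dAction (vary (cavg L UB) (Γ t) 1) (Ψ' t) (perWin d (N * L ^ (j + 1))))
      T c (48 * d) θ κ θ₀ (residualScale d L N b g (j + 1)) := by
  have hP : 1 ≤ N * L ^ (j + 1) := Nat.mul_pos (by omega) (Nat.pow_pos (by omega))
  have hW : IsUnitaryCfg (cavg L UB) := isUnitaryCfg_cavg_of_regular hL j hb hbε hsmall hreg
  have hΨ1P : IsPeriodicDir (Ψ 1) ((N * L ^ (j + 1) : ℕ) : ℤ) :=
    isPeriodicDir_vel h.per (h.vel 1 ⟨zero_le_one, le_rfl⟩)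
  refine routeLeaves_of_chartLeaves hP hW h fun D hD => ?_
  exact abs_deriv_action_le_residualScale hL j hb hbε hsmall hB hreg (Ψ 1) h.skewEnd hΨ1P hXT hD

/-- **THE ROOT T-E OVER `sfClass` FROM THE CHART'S LEAVES (unit-scale currency).**  If for every level `j+1 ≥ 1`, every
datum `V ∈ dom` and every pair of minimisers `(U_A, U_B)` of `sfClass d L N ε` (runs `j+1`, `j+2`) with `U_B`
`Regular d L N b g (j+2)` there are chart leaves in the unit-scale norm with UNIFORM constants `(c, θ, κ, θ₀, a)` and a
tangent datum tangent to run A's fibre, under row Y9's multi-level smallness at every level, `0 ≤ b < ε`, `0 < c`,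
`0 ≤ θ₀` and the modulus budget `2·(48d)·θ + (48d)·θ² + κ ≤ c∕2`, then
`NE3EnergyRate d (sfClass d L N ε) L N b g ((1+θ₀)·(2∕c)) dom` (`NE3EnergyAssembly.ne3EnergyRate_of_routeLeaves` BY NAME
over `routeLeaves_sfClass_of_chartLeaves`).  HONEST: a valid implication whose hypothesis `coer` with ONE `c` for all levels
has no inhabitant on B11's tangent spaces in this currency (F-ne3p1-g19-1 §1) — recorded so that the unit-scale road's END
is in the tree exactly as typed, not as a claim that the road lives. [folklore] -/
theorem ne3EnergyRate_sfClass_of_chartLeaves [Nonempty n] {L N : ℕ} [NeZero L] [NeZero N] (hL : 1 ≤ L) (hN : 1 ≤ N)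
    {ε b g : ℝ} (hb : 0 ≤ b) (hbε : b < ε)
    (hsmall : ∀ j : ℕ, LevelSmall d L (j + 1) (ε / ((L : ℝ) ^ (j + 2)) ^ 2))
    {dom : Set (Site d → Fin d → (Matrix n n ℂ)ˣ)} {c θ κ θ₀ a : ℝ} (hθ₀ : 0 ≤ θ₀) (hc : 0 < c)
    (hbudget : 2 * (48 * (d : ℝ)) * θ + (48 * (d : ℝ)) * θ ^ 2 + κ ≤ c / 2)
    (hchart : ∀ j : ℕ, ∀ V ∈ dom, ∀ UA UB : Site d → Fin d → (Matrix n n ℂ)ˣ,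
      IsMinimiser d (sfClass d L N ε) L N (j + 1) V UA → IsMinimiser d (sfClass d L N ε) L N (j + 2) V UB →
        Regular d L N b g (j + 2) UB →
          ∃ (u : Site d → (Matrix n n ℂ)ˣ) (Γ Ψ Ψ' : ℝ → Site d → Fin d → Matrix n n ℂ)
            (T : Set (Site d → Fin d → Matrix n n ℂ)),
            ChartLeaves (sfClass d L N ε) L N (j + 1) V UA UB u Γ Ψ Ψ' T
                (fun Y => energyNorm (cavg L UB) Y (periodBox (N * L ^ (j + 1)))) c θ κ θ₀ a ∧
              TangentIter L j (cavg L UB) (Ψ 1)) :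
    NE3EnergyRate d (sfClass d L N ε) L N b g ((1 + θ₀) * (2 / c)) dom := by
  have hΛ : (0 : ℝ) ≤ 48 * (d : ℝ) := by positivity
  refine ne3EnergyRate_of_routeLeaves hL hΛ hθ₀ hc hbudget fun k hk V hV UA UB hA hB hreg => ?_
  obtain ⟨j, rfl⟩ : ∃ j, k = j + 1 := ⟨k - 1, by omega⟩
  obtain ⟨u, Γ, Ψ, Ψ', T, h, hXT⟩ := hchart j V hV UA UB hA hB hreg
  exact ⟨u, Ψ 1, Γ, _, _, _, _, _, _, T, routeLeaves_sfClass_of_chartLeaves hL hN j hb hbε (hsmall j) hB hreg h hXT⟩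

end

end Summit.QuantumFields.BalabanUV.T4Continuum.NE3EnergyChartLeaves
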